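import Mathlib
import Literature.Computability.Complexity.RangeAvoidance
import Literature.Computability.Complexity.CNF
import Summits.PneNP.PneNP.Theorems.PstarPDT

/-!
# The fibre `I(z) = y` of a local map as a CNF over `ℕ`-indexed variables (ROUND-24 pre-seed, item T24.0c)

FRONTIER range-avoidance ladder, rung F-N3 (cell `pnp-ideate`; restricted-model proof complexity — nothing here bears on `P` vs `NP`).

The tree's resolution-over-parities library (`Literature.Computability.MetaComplexity.ResLin`, `…ResLinProverDelayer`:
`IsResLinRefutation (φ : CNF ℕ) π`, the coins game and `ProverDelayer.two_pow_le_length_of_guarantees`) refutes CNFs over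
`ℕ`-indexed variables.  This file supplies the CNF of a fibre: for `I : LocalMap k n m` and a target `y`, `fibreCNF I y` has, for
every output `j` and every slot pattern `u : Fin k → Bool` with `I.table j u ≠ y j`, the width-`k` clause "the slots of `j` do not
read `u`" on the variables `(I.vars j i).val`.  `eval_fibreCNF_iff`: an assignment `σ : ℕ → Bool` satisfies it iff
`I.eval (σ ∘ Fin.val) = y`; `satisfiable_fibreCNF_iff`: it is satisfiable iff `y ∈ Range(I)`.  So "tree-like `Res(⊕)` refutations
of `fibreCNF I y` are long for every non-image `y`" is the library-native form of the ROUND-24 research statement (memo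
HOME/pnp-ideate-p3/r24/ROUND-24-PRESEED.md §7), to be attacked by a Delayer `Strategy` with `Guarantees (fibreCNF I y) δ (n / c)`.
-/

set_option linter.dupNamespace false

open Literature.Computability.Complexity

namespace Summit.PneNP.PneNP.Theorems.PstarFibreCNF

variable {k n m : ℕ}

/-- The clause "output `j` does not read the slot pattern `u`": some slot `i` carries the value `¬ u i`. -/
def patternClause (I : LocalMap k n m) (j : Fin m) (u : Fin k → Bool) : Clause ℕ :=
  List.ofFn fun i : Fin k => ((I.vars j i).val, !u i)

/-- The clauses of output `j` for target bit `y j`: one `patternClause` per falsifying pattern. -/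
noncomputable def outputClauses (I : LocalMap k n m) (y : Fin m → Bool) (j : Fin m) : CNF ℕ :=
  ((Finset.univ : Finset (Fin k → Bool)).toList.filter fun u => I.table j u ≠ y j).map (patternClause I j)

/-- **The fibre CNF**: the conjunction over all outputs of their clauses; variables are `(I.vars j i).val < n`. -/
noncomputable def fibreCNF (I : LocalMap k n m) (y : Fin m → Bool) : CNF ℕ :=
  (List.finRange m).flatMap (outputClauses I y)

/-- A pattern clause is true under `σ` iff the slots of `j` do not read exactly `u`. -/
theorem eval_patternClause_iff (I : LocalMap k n m) (j : Fin m) (u : Fin k → Bool) (σ : ℕ → Bool) :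
    Clause.eval σ (patternClause I j u) = true ↔ (fun i => σ (I.vars j i).val) ≠ u := by
  unfold Clause.eval patternClause
  rw [List.any_eq_true]
  constructor
  · rintro ⟨l, hl, hle⟩ hwu
    obtain ⟨i, rfl⟩ := List.mem_ofFn.1 hl
    have hi : σ (I.vars j i).val = u i := by simpa using congrFun hwu i
    simp only [Literal.eval, beq_iff_eq] at hle
    rw [hi] at hle
    revert hle
    cases u i <;> simp
  · intro hne
    have : ∃ i, σ (I.vars j i).val ≠ u i := by
      by_contra hall
      push Not at hall
      exact hne (funext hall)
    obtain ⟨i, hi⟩ := this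
    refine ⟨((I.vars j i).val, !u i), List.mem_ofFn.2 ⟨i, rfl⟩, ?_⟩
    simp only [Literal.eval, beq_iff_eq]
    revert hi
    cases σ (I.vars j i).val <;> cases u i <;> simp

/-- **Semantics**: `σ` satisfies the fibre CNF iff the local map sends `σ ∘ Fin.val` to `y`. -/
theorem eval_fibreCNF_iff (I : LocalMap k n m) (y : Fin m → Bool) (σ : ℕ → Bool) :
    (fibreCNF I y).eval σ = true ↔ I.eval (fun v => σ v.val) = y := by
  unfold fibreCNF CNF.eval
  rw [List.all_eq_true]
  constructor
  · intro h
    funext j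
    by_contra hj
    let w : Fin k → Bool := fun i => σ (I.vars j i).val
    have hmem : patternClause I j w ∈ (List.finRange m).flatMap (outputClauses I y) := by
      rw [List.mem_flatMap]
      refine ⟨j, List.mem_finRange j, ?_⟩
      unfold outputClauses
      rw [List.mem_map]
      refine ⟨w, ?_, rfl⟩
      rw [List.mem_filter, Finset.mem_toList]
      exact ⟨Finset.mem_univ _, by simpa [LocalMap.eval, w] using hj⟩
    have h1 := h _ hmem
    have h2 : Clause.eval σ (patternClause I j w) = true := h1
    rw [eval_patternClause_iff] at h2
    exact h2 rfl
  · intro h c hc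
    rw [List.mem_flatMap] at hc
    obtain ⟨j, -, hcj⟩ := hc
    unfold outputClauses at hcj
    rw [List.mem_map] at hcj
    obtain ⟨u, hu, rfl⟩ := hcj
    rw [List.mem_filter, Finset.mem_toList] at hu
    have hu' : I.table j u ≠ y j := by simpa using hu.2
    show Clause.eval σ (patternClause I j u) = true
    rw [eval_patternClause_iff]
    intro hwu
    apply hu'
    rw [← hwu]
    exact congrFun h j

/-- **Satisfiable iff in the range**: the CNF to refute is unsatisfiable exactly for the non-image targets. -/
theorem satisfiable_fibreCNF_iff (I : LocalMap k n m) (y : Fin m → Bool) : (fibreCNF I y).Satisfiable ↔ y ∈ I.range := by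
  constructor
  · rintro ⟨σ, hσ⟩
    exact ⟨fun v => σ v.val, (eval_fibreCNF_iff I y σ).1 hσ⟩
  · rintro ⟨z, hz⟩
    refine ⟨fun v => if h : v < n then z ⟨v, h⟩ else false, ?_⟩
    rw [eval_fibreCNF_iff]
    convert hz using 2
    funext v
    simp [v.isLt]

/-- Every clause of the fibre CNF has width `k` (the locality). -/
theorem length_of_mem_fibreCNF (I : LocalMap k n m) (y : Fin m → Bool) {c : Clause ℕ} (hc : c ∈ fibreCNF I y) :
    c.length = k := by
  unfold fibreCNF at hc
  rw [List.mem_flatMap] at hc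
  obtain ⟨j, -, hcj⟩ := hc
  unfold outputClauses at hcj
  rw [List.mem_map] at hcj
  obtain ⟨u, -, rfl⟩ := hcj
  simp [patternClause]

/-- Every variable of the fibre CNF is `< n`. -/
theorem lt_of_mem_fibreCNF (I : LocalMap k n m) (y : Fin m → Bool) {c : Clause ℕ} (hc : c ∈ fibreCNF I y) {l : Literal ℕ}
    (hl : l ∈ c) : l.1 < n := by
  unfold fibreCNF at hc
  rw [List.mem_flatMap] at hc
  obtain ⟨j, -, hcj⟩ := hc
  unfold outputClauses at hcj
  rw [List.mem_map] at hcj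
  obtain ⟨u, -, rfl⟩ := hcj
  rw [patternClause] at hl
  obtain ⟨i, rfl⟩ := List.mem_ofFn.1 hl
  exact (I.vars j i).isLt

end Summit.PneNP.PneNP.Theorems.PstarFibreCNF
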